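import Mathlib.FieldTheory.Finite.Basic
import Mathlib.LinearAlgebra.Matrix.Trace
import Mathlib.LinearAlgebra.Determinant
import Literature.NumberTheory.EllipticCurves.IsogenyDegree
import Literature.NumberTheory.EllipticCurves.IsogenyIdProofs
import Literature.NumberTheory.EllipticCurves.SelmerCorankProofs
import Literature.NumberTheory.EllipticCurves.TateModuleFinrankProofs
import Literature.NumberTheory.EllipticCurves.TateModuleFreeProofs
import HarnessLib

/-!
# The Frobenius endomorphism of an elliptic curve over a finite field (Silverman, *AEC*, V.§1–2)

Topic `NumberTheory/EllipticCurves` (trunk T-ELLARITH). Second layer of the decomposition of the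
named fact `Literature.AlgebraicGeometry.Motives.isIsogenous_iff_card_point_eq` (`Literature.AlgebraicGeometry.Motives.FaltingsEC`:
Tate's isogeny theorem in point-count form), below the named facts
`WeierstrassCurve.trace_galoisRepTate_frobenius` / `det_galoisRepTate_frobenius` of
`Literature.NumberTheory.EllipticCurves.FrobeniusTateModule` (Silverman, *AEC*, 2nd ed.,
Thm. V.2.3.1: `tr(φ_ℓ) = q + 1 - #E(𝔽_q)`, `det(φ_ℓ) = q`). It formalises the two
endomorphisms `φ` (the `q`-power Frobenius) and `1 - φ` of an elliptic curve over a finite field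
as terms of the prelude's `WeierstrassCurve.Isogeny W W` (real definitions), proves the
elementary part of Silverman's proofs of Thm. V.1.1 and Thm. V.2.3.1 about them, and vendors the
three printed inputs of those proofs that the tree does not prove as named facts over these real
objects (D-0014), so that the bodies of the two V.2.3.1 facts follow (`…_of_facts` theorems).

## Contents

Let `k` be a finite field with `q` elements, `E / k` an elliptic curve (`W : WeierstrassCurve k`,
`[W.IsElliptic]`), `σ_q ∈ Γ_k` the arithmetic Frobenius (`σ_q x = x ^ q` on `k̄`; hypothesis
`hσ`, as in `FrobeniusTateModule`), `ℓ` a prime.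

* `WeierstrassCurve.frobenius_mul_comm`: `σ_q` is central in `Γ_k`;
  `mem_range_algebraMap_of_pow_card_eq`: `x ^ q = x ⇒ x ∈ k` (roots of `X^q - X`).
* `WeierstrassCurve.smul_eq_self_iff_mem_range_toGeomPoints`: **the `σ_q`-fixed geometric
  points are exactly `E(k)`**, the image of the tree's inclusion `toGeomPoints W : E(k) →+ E(k̄)`
  (`SelmerCorankProofs`; proof of Thm. V.1.1: "`P ∈ E(𝔽_q)` if and only if `φ(P) = P`" — for the
  Frobenius alone, by counting roots of `X^q - X`, not through Galois descent for all of `Γ_k`);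
  `finite_point`: `E(k)` is finite.
* `WeierstrassCurve.frobeniusIsogeny W hσ : Isogeny W W` — **the `q`-power Frobenius
  endomorphism `φ : (x, y) ↦ (x^q, y^q)`** (Example III.4.6, V.§2): the action of `σ_q` on `E(k̄)`,
  algebraic through `(X^q/1, Y^q/1)` off `{O}`, commuting with `Γ_k`, kernel `{O}`;
  `tateModule_map_frobeniusIsogeny`: **`T_ℓ(φ) = W.galoisRepTate ℓ σ_q`** (Silverman's `φ_ℓ` is
  the Galois action of `σ_q` on `T_ℓ E`, definitionally).
* `WeierstrassCurve.oneSubFrobeniusIsogeny W hσ : Isogeny W W` — **the endomorphism `1 - φ`**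
  (V.§1): `P ↦ P - σ_q P`, algebraic by the tree's theorem that a sum of isogenies is zero or
  algebraic (`Isogeny.add_toAddMonoidHom_eq_zero_or_isAlgebraicOn`, III.§4) — it is not zero as
  `E(k̄)` is infinite with finitely many `σ_q`-fixed points; `kerOneSubFrobeniusEquiv`:
  **`E(k) ≃ ker(1 - φ)`**, `card_ker_oneSubFrobeniusIsogeny`: `#ker(1 - φ) = #E(k)`;
  `tateModule_map_oneSubFrobeniusIsogeny`: `T_ℓ(1 - φ) = 1 - φ_ℓ`.
* Named facts (each quantifying its instance hypotheses in the body):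
  * `WeierstrassCurve.Isogeny.det_tateModule_map_eq_deg W ℓ` — *AEC* Prop. III.8.6 (= V.2.3):
    `det(ψ_ℓ) = deg ψ` for `ψ ∈ End_K(E)` non-zero, `ℓ ≠ char K` (proved in print with the Weil
    pairing; `deg` is the real `Isogeny.deg = [K̄(E) : ψ^* K̄(E)]` of `IsogenyDegree`);
  * `WeierstrassCurve.frobeniusIsogeny_deg_eq_card W` — *AEC* Prop. II.2.11(c): `deg φ = q`;
  * `WeierstrassCurve.isSeparable_oneSubFrobeniusIsogeny W` — *AEC* Cor. III.5.5: `1 - φ` is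
    separable (`K̄(E) / (1 - φ)^* K̄(E)` separable).
* `trace_eq_one_add_det_sub_det`: `tr(A) = 1 + det(A) - det(1 - A)` on the rank-`2` lattice
  `T_ℓ E` (end of the proof of III.8.6).
* **Assembly** (the printed proof of Thm. V.2.3.1 with that of Thm. V.1.1):
  `det_galoisRepTate_frobenius_of_facts` (`det(φ_ℓ) = deg φ = q`, from III.8.6 and II.2.11(c)),
  `deg_oneSubFrobeniusIsogeny_eq_card_of_facts` (`deg(1 - φ) = #ker(1 - φ) = #E(k)`, from
  III.5.5 and III.4.10(a) — the latter is the tree's named fact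
  `Isogeny.card_ker_eq_finSepDegree W W` of `IsogenyDegree`), and
  `trace_galoisRepTate_frobenius_of_facts`:
  `tr(φ_ℓ) = 1 + det(φ_ℓ) - det(1 - φ_ℓ) = 1 + q - deg(1 - φ) = q + 1 - #E(k)`.
  The conclusions are literally the bodies of `det_galoisRepTate_frobenius W ℓ` and
  `trace_galoisRepTate_frobenius W ℓ` of `FrobeniusTateModule`, which are thereby reduced to
  III.8.6, II.2.11(c), III.4.10(a) and III.5.5.

## Status of the named facts (D-0014; updated)

When this file was written none of the four printed inputs was in the tree. Since then:

* III.5.5 is **proved**: `isSeparable_oneSubFrobeniusIsogeny_holds`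
  (`Literature.NumberTheory.EllipticCurves.FrobeniusSeparableProofs`, a differential-free proof);
* III.4.10(a) is **proved**: `Isogeny.card_ker_eq_finSepDegree_holds`
  (`Literature.NumberTheory.EllipticCurves.IsogenyDegreeKernelProofs`);
* II.2.11(c) is **proved**: `frobeniusIsogeny_deg_eq_card_holds`
  (`Literature.NumberTheory.EllipticCurves.FrobeniusDegreeProofs`: `[K̄(x) : K̄(x^q)] = q` by
  Eisenstein and Gauss, and a degree count);
* III.8.6 is **reduced to Cor. III.6.3** (`deg` is a quadratic form on `End_K(E)`, the named fact
  `degHom_isQuadraticForm W W` of `IsogenyDegree`):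
  `Isogeny.det_tateModule_map_eq_deg_of_isQuadraticForm`
  (`Literature.NumberTheory.EllipticCurves.IsogenyDeterminantProofs`, not Silverman's Weil-pairing
  proof; the Weil pairing of III.8.1 is in the tree as the named fact `exists_weilPairing`,
  `Literature.NumberTheory.EllipticCurves.WeilPairing`, and gives `det(φ_ℓ) = q` directly,
  `Literature.NumberTheory.EllipticCurves.TateModuleDeterminantProofs`).

So the two facts of `FrobeniusTateModule` now follow from `degHom_isQuadraticForm W W` alone
(`det/trace_galoisRepTate_frobenius_of_isQuadraticForm_of_deg` of `IsogenyDeterminantProofs` fed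
with `frobeniusIsogeny_deg_eq_card_holds`).

## References

* [SilvermanAEC2009] J. H. Silverman, *The Arithmetic of Elliptic Curves*, 2nd ed., GTM 106,
  Springer 2009 (held: `book:silverman2009-arithmetic-elliptic-curves-2nd-ed`): Prop. II.2.11
  (PDF p. 35), Example III.4.6 (PDF p. 70), Thm. III.4.10 (PDF p. 71), Cor. III.5.5 (PDF p. 76), Prop. III.8.6
  with its proof (PDF p. 92), Thm. V.1.1 with its proof (PDF p. 126), Prop. V.2.3 and Thm. V.2.3.1
  with its proof (PDF pp. 129–130).
* [Tate1966Endomorphisms] J. Tate, *Endomorphisms of abelian varieties over finite fields*,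
  Invent. Math. 2 (1966), 134–144, §1 and §3 (the consumer, through `FrobeniusTateModule` and
  `Literature.AlgebraicGeometry.Motives.FaltingsECCardProofs`).

## Design

`noncomputable section`, `open scoped Classical`, one universe `u`, deliberate dot-notation
extensions in `namespace WeierstrassCurve` (as the preludes `Isogeny`, `IsogenyDegree`,
`TateModule`). The Frobenius is an arbitrary `σ ∈ Γ_k` with `σ x = x ^ Nat.card k` rather than
Mathlib's `FiniteField.frobeniusAlgEquivOfAlgebraic` (which needs `[Fintype k]`), so that the
statements match `FrobeniusTateModule` verbatim and carry no `Fintype` instance; such a `σ` exists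
and is unique (`WeierstrassCurve.exists_frobenius_absoluteGaloisGroup`, loc. cit.). The two
isogenies are honest structure terms (all four fields proved), the three facts are `Prop`-valued
`def`s with the source's numbering, and the file imports no Motives file (the consumer imports it).
-/

noncomputable section

open scoped Classical
open Polynomial

universe u

namespace WeierstrassCurve

open Literature.NumberTheory.EllipticCurves

variable {K : Type u} [Field K]

/-! ## The arithmetic Frobenius of a finite field -/

section FrobeniusElement

variable {σ : Field.absoluteGaloisGroup K}

/-- An element `σ_q ∈ Γ_k` acting on `k̄` by `x ↦ x ^ q` commutes with every element of `Γ_k`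
(a ring homomorphism commutes with `x ↦ x ^ q`). [folklore] -/
theorem frobenius_mul_comm (hσ : ∀ x : AlgebraicClosure K, σ • x = x ^ Nat.card K)
    (τ : Field.absoluteGaloisGroup K) : σ * τ = τ * σ := by
  refine AlgEquiv.ext fun x ↦ ?_
  change σ • τ • x = τ • σ • x
  rw [hσ, hσ, smul_pow']

variable [Finite K]

/-- An element of `k̄` fixed by the `q`-power map lies in `k` (the `q` elements of `k` are `q`
roots of `X ^ q - X`, which has no others). [folklore] -/
theorem mem_range_algebraMap_of_pow_card_eq {x : AlgebraicClosure K} (hx : x ^ Nat.card K = x) :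
    x ∈ Set.range (algebraMap K (AlgebraicClosure K)) := by
  letI := Fintype.ofFinite K
  rw [Nat.card_eq_fintype_card] at hx
  set f : K[X] := X ^ Fintype.card K - X with hf
  have hf0 : f ≠ 0 := FiniteField.X_pow_card_sub_X_ne_zero K Fintype.one_lt_card
  have hsplit : f.Splits := by
    rw [splits_iff_card_roots, hf, FiniteField.roots_X_pow_card_sub_X,
      FiniteField.X_pow_card_sub_X_natDegree_eq K Fintype.one_lt_card]
    rfl
  have hroot : (f.map (algebraMap K (AlgebraicClosure K))).IsRoot x := by
    simp only [hf, Polynomial.map_sub, Polynomial.map_pow, map_X, IsRoot.def, eval_sub, eval_pow,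
      eval_X, hx, sub_self]
  obtain ⟨a, ha⟩ := hsplit.mem_range_of_isRoot hf0 hroot
  exact ⟨a, ha⟩

/-- Conversely the image of `k` in `k̄` is fixed by the `q`-power map. [folklore] -/
theorem algebraMap_pow_card (a : K) :
    algebraMap K (AlgebraicClosure K) a ^ Nat.card K = algebraMap K (AlgebraicClosure K) a := by
  letI := Fintype.ofFinite K
  rw [Nat.card_eq_fintype_card, ← map_pow, FiniteField.pow_card]

end FrobeniusElement

/-! ## `k`-rational points inside the geometric points -/

section Points

variable {W : WeierstrassCurve K}

/-- **`E(k) = {P ∈ E(k̄) | σ_q P = P}`** for a finite field `k` with `q` elements and the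
arithmetic Frobenius `σ_q` (`σ_q x = x ^ q`): a geometric point fixed by `σ_q` has coordinates
fixed by the `q`-power map, hence in `k`. Silverman, *AEC*, V.§1, proof of Thm. V.1.1
("`P ∈ E(𝔽_q)` if and only if `φ(P) = P`"). [cite: SilvermanAEC2009, proof of Thm. V.1.1] -/
theorem mem_range_toGeomPoints_of_smul_eq [Finite K] {σ : Field.absoluteGaloisGroup K}
    (hσ : ∀ x : AlgebraicClosure K, σ • x = x ^ Nat.card K) {P : W.geomPoints} (hP : σ • P = P) :
    P ∈ Set.range W.toGeomPoints := by
  change (W.baseChange (AlgebraicClosure K)).toAffine.Point at P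
  rcases P with _ | ⟨x, y, h⟩
  · exact ⟨0, rfl⟩
  · have hmap : Affine.Point.map
        ((show AlgebraicClosure K ≃ₐ[K] AlgebraicClosure K from σ) :
          AlgebraicClosure K →ₐ[K] AlgebraicClosure K) (.some x y h) = .some x y h := hP
    rw [Affine.Point.map_some] at hmap
    simp only [Affine.Point.some.injEq] at hmap
    obtain ⟨hx, hy⟩ := hmap
    replace hx : x ^ Nat.card K = x := (hσ x).symm.trans hx
    replace hy : y ^ Nat.card K = y := (hσ y).symm.trans hy
    obtain ⟨x₀, rfl⟩ := mem_range_algebraMap_of_pow_card_eq hx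
    obtain ⟨y₀, rfl⟩ := mem_range_algebraMap_of_pow_card_eq hy
    have h₀ : W.toAffine.Nonsingular x₀ y₀ :=
      (Affine.baseChange_nonsingular W (Algebra.ofId K (AlgebraicClosure K)).injective x₀ y₀).mp h
    exact ⟨Affine.Point.some x₀ y₀ h₀, rfl⟩

/-- For `k` finite and `σ_q` the arithmetic Frobenius, the `σ_q`-fixed geometric points are
exactly the image of `E(k)`. Silverman, *AEC*, V.§1, proof of Thm. V.1.1.
[cite: SilvermanAEC2009, proof of Thm. V.1.1] -/
theorem smul_eq_self_iff_mem_range_toGeomPoints [Finite K] {σ : Field.absoluteGaloisGroup K}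
    (hσ : ∀ x : AlgebraicClosure K, σ • x = x ^ Nat.card K) (P : W.geomPoints) :
    σ • P = P ↔ P ∈ Set.range W.toGeomPoints := by
  refine ⟨mem_range_toGeomPoints_of_smul_eq hσ, ?_⟩
  rintro ⟨P₀, rfl⟩
  exact smul_toGeomPoints W σ P₀

end Points

/-! ## The Frobenius isogeny `φ : E → E` -/

section Frobenius

open MvPolynomial

variable (W : WeierstrassCurve K) {σ : Field.absoluteGaloisGroup K}

/-- The map `P ↦ σ_q P` agrees at every affine point with the polynomial map
`(x, y) ↦ (x ^ q, y ^ q)`. Silverman, *AEC*, Example III.4.6 and V.§2 (the `q`-power Frobenius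
`φ : (x, y) ↦ (x^q, y^q)`). [folklore] -/
theorem agreesWithRationalMapAt_frobenius (hσ : ∀ x : AlgebraicClosure K, σ • x = x ^ Nat.card K)
    {P : W.geomPoints} (hP : P ≠ 0) :
    AgreesWithRationalMapAt W W (X 0 ^ Nat.card K) 1 (X 1 ^ Nat.card K) 1 (fun Q ↦ σ • Q) P := by
  change (W.baseChange (AlgebraicClosure K)).toAffine.Point at P
  rcases P with _ | ⟨x, y, h⟩
  · exact absurd rfl hP
  · refine ⟨x, y, h, rfl, by simp, by simp, ?_⟩
    have hmap : σ • (show W.geomPoints from Affine.Point.some x y h) =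
        Affine.Point.some (σ • x) (σ • y)
          ((Affine.baseChange_nonsingular W
            ((show AlgebraicClosure K ≃ₐ[K] AlgebraicClosure K from σ) :
              AlgebraicClosure K →ₐ[K] AlgebraicClosure K).injective x y).mpr h) := by
      change Affine.Point.map
          ((show AlgebraicClosure K ≃ₐ[K] AlgebraicClosure K from σ) :
            AlgebraicClosure K →ₐ[K] AlgebraicClosure K) (.some x y h) = _
      rw [Affine.Point.map_some]
      rfl
    have e1 : MvPolynomial.eval ![x, y] (X 0 ^ Nat.card K) / MvPolynomial.eval ![x, y] 1 = σ • x := by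
      simp [hσ]
    have e2 : MvPolynomial.eval ![x, y] (X 1 ^ Nat.card K) / MvPolynomial.eval ![x, y] 1 = σ • y := by
      simp [hσ]
    rw [e1, e2]
    exact ⟨_, hmap⟩

/-- The map `P ↦ σ_q P` on `E(k̄)` is algebraic (given by `(x ^ q, y ^ q)` off `{O}`).
Silverman, *AEC*, Example III.4.6. [folklore] -/
theorem isAlgebraicOn_frobenius (hσ : ∀ x : AlgebraicClosure K, σ • x = x ^ Nat.card K) :
    IsAlgebraicOn W W (fun Q : W.geomPoints ↦ σ • Q) :=
  ⟨X 0 ^ Nat.card K, 1, X 1 ^ Nat.card K, 1,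
    (Set.finite_singleton (0 : W.geomPoints)).subset fun P hP ↦ by
      by_contra h0
      exact hP (agreesWithRationalMapAt_frobenius W hσ h0)⟩

/-- **The `q`-power Frobenius endomorphism** `φ : E → E`, `(x, y) ↦ (x^q, y^q)`, of a
Weierstrass curve over a finite field `k` with `q` elements (Silverman, *AEC*, Example III.4.6, V.§1–2),
as a term of the prelude's `Isogeny W W`: on geometric points it is the action of the arithmetic
Frobenius `σ_q ∈ Γ_k` (`σ_q x = x ^ q` on `k̄`; hypothesis `hσ`, satisfied by exactly one
element of `Γ_k`), which is a group homomorphism, algebraic via `(x ^ q, y ^ q)` off `{O}`,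
commutes with `Γ_k`, and is injective (kernel `{O}`; `φ` is purely inseparable of degree `q`,
*AEC* II.2.11). [cite: SilvermanAEC2009, Example III.4.6] -/
def frobeniusIsogeny (hσ : ∀ x : AlgebraicClosure K, σ • x = x ^ Nat.card K) : Isogeny W W where
  toAddMonoidHom := DistribSMul.toAddMonoidHom W.geomPoints σ
  isAlgebraic := isAlgebraicOn_frobenius W hσ
  equivariant τ P := by
    change σ • τ • P = τ • σ • P
    rw [← mul_smul, ← mul_smul, frobenius_mul_comm hσ τ]
  finite_ker := by
    refine (Set.finite_singleton (0 : W.geomPoints)).subset fun P hP ↦ ?_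
    have hP' : σ • P = 0 := hP
    have : P = σ⁻¹ • σ • P := (inv_smul_smul σ P).symm
    rw [this, hP', smul_zero]
    rfl

/-- The Frobenius isogeny acts on `E(k̄)` as `σ_q`. [folklore] -/
@[simp]
theorem frobeniusIsogeny_apply (hσ : ∀ x : AlgebraicClosure K, σ • x = x ^ Nat.card K)
    (P : W.geomPoints) : W.frobeniusIsogeny hσ P = σ • P :=
  rfl

/-- The underlying homomorphism of the Frobenius isogeny is the action of `σ_q`. [folklore] -/
theorem frobeniusIsogeny_toAddMonoidHom (hσ : ∀ x : AlgebraicClosure K, σ • x = x ^ Nat.card K) :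
    (W.frobeniusIsogeny hσ).toAddMonoidHom = DistribSMul.toAddMonoidHom W.geomPoints σ :=
  rfl

/-- **`φ_ℓ = T_ℓ(φ)` is the action of `σ_q` on the Tate module**: the `ℤ_ℓ`-linear map induced
by the Frobenius isogeny on `T_ℓ E` is `W.galoisRepTate ℓ σ_q` (componentwise both are `σ_q`).
Silverman, *AEC*, III.§7 and V.§2. [folklore] -/
theorem tateModule_map_frobeniusIsogeny (hσ : ∀ x : AlgebraicClosure K, σ • x = x ^ Nat.card K)
    (ℓ : ℕ) [Fact ℓ.Prime] :
    TateModule.map ℓ (W.frobeniusIsogeny hσ).toAddMonoidHom = W.galoisRepTate ℓ σ :=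
  LinearMap.ext fun _ ↦ TateModule.ext fun _ ↦ rfl

end Frobenius

/-! ## `E(k)` is finite -/

section Finite

variable (W : WeierstrassCurve K)

/-- Over a finite field the (type of) `k`-rational points `E(k)` (Mathlib's `W.toAffine.Point`:
the nonsingular affine `k`-points and `O`) is finite: it injects into `Option (k × k)`.
Silverman, *AEC*, V.§1 (`#E(𝔽_q) ≤ 2q + 1`). [folklore] -/
theorem finite_point [Finite K] : Finite W.toAffine.Point := by
  refine Finite.of_injective (fun P : W.toAffine.Point ↦ match P with
    | .zero => (none : Option (K × K))
    | .some x y _ => some (x, y)) ?_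
  rintro (_ | ⟨x, y, h⟩) (_ | ⟨x', y', h'⟩) hPQ
  · rfl
  · exact (Option.some_ne_none _ hPQ.symm).elim
  · exact (Option.some_ne_none _ hPQ).elim
  · simp only [Option.some.injEq, Prod.mk.injEq] at hPQ
    obtain ⟨rfl, rfl⟩ := hPQ
    rfl

end Finite

/-! ## The isogeny `1 - φ` and its kernel `E(k)` -/

section OneSubFrobenius

variable (W : WeierstrassCurve K) [Finite K] {σ : Field.absoluteGaloisGroup K}

/-- Only finitely many geometric points are fixed by the arithmetic Frobenius `σ_q` (they come
from the finite set `E(k)`). Silverman, *AEC*, V.§1. [folklore] -/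
theorem finite_setOf_frobenius_smul_eq (hσ : ∀ x : AlgebraicClosure K, σ • x = x ^ Nat.card K) :
    {P : W.geomPoints | σ • P = P}.Finite := by
  haveI := finite_point W
  exact (Set.finite_range W.toGeomPoints).subset fun P hP ↦
    (smul_eq_self_iff_mem_range_toGeomPoints hσ P).mp hP

variable [W.IsElliptic]

/-- The map `P ↦ P - σ_q P` on `E(k̄)` is algebraic: it is the sum of the identity isogeny and
the negative of the Frobenius isogeny, which is either zero or algebraic (the tree's theorem
`Isogeny.add_toAddMonoidHom_eq_zero_or_isAlgebraicOn`, Silverman, *AEC*, III.§4: `Hom(E, E)` is a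
group), and it is not zero since `E(k̄)` is infinite while only finitely many points are fixed by
`σ_q`. Silverman, *AEC*, III.§4 and V.§1 (the endomorphism `1 - φ`). [folklore] -/
theorem isAlgebraicOn_id_sub_frobenius (hσ : ∀ x : AlgebraicClosure K, σ • x = x ^ Nat.card K) :
    IsAlgebraicOn W W
      ⇑(AddMonoidHom.id W.geomPoints - DistribSMul.toAddMonoidHom W.geomPoints σ) := by
  obtain ⟨χ, hχ⟩ := (W.frobeniusIsogeny hσ).exists_toAddMonoidHom_eq_neg
  have hsum : (Isogeny.id W).toAddMonoidHom + χ.toAddMonoidHom =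
      AddMonoidHom.id W.geomPoints - DistribSMul.toAddMonoidHom W.geomPoints σ := by
    rw [hχ, frobeniusIsogeny_toAddMonoidHom, ← sub_eq_add_neg]
    rfl
  rcases (Isogeny.id W).add_toAddMonoidHom_eq_zero_or_isAlgebraicOn χ with h0 | halg
  · exfalso
    rw [hsum] at h0
    have hall : ∀ P : W.geomPoints, σ • P = P := fun P ↦ by
      have hP := DFunLike.congr_fun h0 P
      rw [AddMonoidHom.sub_apply, AddMonoidHom.zero_apply, sub_eq_zero] at hP
      exact hP.symm
    have hfin := finite_setOf_frobenius_smul_eq W hσ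
    rw [Set.eq_univ_of_forall (s := {P : W.geomPoints | σ • P = P}) hall] at hfin
    exact Set.infinite_univ hfin
  · rwa [hsum] at halg

/-- **The isogeny `1 - φ : E → E`**, `P ↦ P - φ(P)`, for the `q`-power Frobenius endomorphism
`φ` of an elliptic curve over a finite field with `q` elements (Silverman, *AEC*, V.§1, proof of
Thm. V.1.1; III.5.5), as a term of the prelude's `Isogeny W W`: the homomorphism
`P ↦ P - σ_q P` of `E(k̄)`, algebraic (`isAlgebraicOn_id_sub_frobenius`), commuting with `Γ_k`,
with finite kernel (the `σ_q`-fixed points, i.e. `E(k)`). [cite: SilvermanAEC2009, proof of Thm. V.1.1] -/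
def oneSubFrobeniusIsogeny (hσ : ∀ x : AlgebraicClosure K, σ • x = x ^ Nat.card K) :
    Isogeny W W where
  toAddMonoidHom := AddMonoidHom.id W.geomPoints - DistribSMul.toAddMonoidHom W.geomPoints σ
  isAlgebraic := isAlgebraicOn_id_sub_frobenius W hσ
  equivariant τ P := by
    change τ • P - σ • τ • P = τ • (P - σ • P)
    rw [smul_sub, ← mul_smul, ← mul_smul, frobenius_mul_comm hσ τ]
  finite_ker := (isAlgebraicOn_id_sub_frobenius W hσ).finite_ker

/-- `(1 - φ)(P) = P - σ_q P`. [folklore] -/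
@[simp]
theorem oneSubFrobeniusIsogeny_apply (hσ : ∀ x : AlgebraicClosure K, σ • x = x ^ Nat.card K)
    (P : W.geomPoints) : W.oneSubFrobeniusIsogeny hσ P = P - σ • P :=
  rfl

/-- The homomorphism underlying `1 - φ` is the difference of those underlying `1` and `φ`.
[folklore] -/
theorem oneSubFrobeniusIsogeny_toAddMonoidHom
    (hσ : ∀ x : AlgebraicClosure K, σ • x = x ^ Nat.card K) :
    (W.oneSubFrobeniusIsogeny hσ).toAddMonoidHom =
      (Isogeny.id W).toAddMonoidHom - (W.frobeniusIsogeny hσ).toAddMonoidHom :=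
  rfl

/-- **`ker(1 - φ)` is the set of `σ_q`-fixed points.** [folklore] -/
theorem mem_ker_oneSubFrobeniusIsogeny_iff (hσ : ∀ x : AlgebraicClosure K, σ • x = x ^ Nat.card K)
    (P : W.geomPoints) :
    P ∈ (W.oneSubFrobeniusIsogeny hσ).toAddMonoidHom.ker ↔ σ • P = P := by
  rw [AddMonoidHom.mem_ker]
  change P - σ • P = 0 ↔ _
  rw [sub_eq_zero, eq_comm]

/-- **`E(k) ≅ ker(1 - φ)`**: the base change `E(k) → E(k̄)` is a bijection onto the kernel of
`1 - φ` (injective, with image the `σ_q`-fixed points). Silverman, *AEC*, V.§1, proof of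
Thm. V.1.1 ("`E(𝔽_q) = ker(1 - φ)`"). [cite: SilvermanAEC2009, proof of Thm. V.1.1] -/
def kerOneSubFrobeniusEquiv (hσ : ∀ x : AlgebraicClosure K, σ • x = x ^ Nat.card K) :
    W.toAffine.Point ≃ (W.oneSubFrobeniusIsogeny hσ).toAddMonoidHom.ker :=
  Equiv.ofBijective
    (fun P ↦ ⟨W.toGeomPoints P,
      (mem_ker_oneSubFrobeniusIsogeny_iff W hσ _).mpr (smul_toGeomPoints W σ P)⟩)
    ⟨fun P Q hPQ ↦ toGeomPoints_injective W (congrArg Subtype.val hPQ), fun ⟨P, hP⟩ ↦ by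
      obtain ⟨P₀, rfl⟩ := mem_range_toGeomPoints_of_smul_eq hσ
        ((mem_ker_oneSubFrobeniusIsogeny_iff W hσ P).mp hP)
      exact ⟨P₀, rfl⟩⟩

/-- **`#ker(1 - φ) = #E(k)`.** Silverman, *AEC*, V.§1, proof of Thm. V.1.1.
[cite: SilvermanAEC2009, proof of Thm. V.1.1] -/
theorem card_ker_oneSubFrobeniusIsogeny (hσ : ∀ x : AlgebraicClosure K, σ • x = x ^ Nat.card K) :
    Nat.card (W.oneSubFrobeniusIsogeny hσ).toAddMonoidHom.ker = Nat.card W.toAffine.Point :=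
  (Nat.card_congr (W.kerOneSubFrobeniusEquiv hσ)).symm

/-- **`T_ℓ(1 - φ) = 1 - φ_ℓ`** on the Tate module. Silverman, *AEC*, III.§7. [folklore] -/
theorem tateModule_map_oneSubFrobeniusIsogeny
    (hσ : ∀ x : AlgebraicClosure K, σ • x = x ^ Nat.card K) (ℓ : ℕ) [Fact ℓ.Prime] :
    TateModule.map ℓ (W.oneSubFrobeniusIsogeny hσ).toAddMonoidHom =
      LinearMap.id - W.galoisRepTate ℓ σ := by
  refine LinearMap.ext fun a ↦ TateModule.ext fun n ↦ ?_
  change TateModule.proj ℓ n a - σ • TateModule.proj ℓ n a = TateModule.proj ℓ n (a - σ • a)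
  rw [map_sub, TateModule.proj_smul_of_distribMulAction]

end OneSubFrobenius

/-! ## The named facts (Silverman, *AEC*, Prop. III.8.6, Prop. II.2.11(c), Cor. III.5.5) -/

section Facts

variable (W : WeierstrassCurve K) (ℓ : ℕ) [Fact ℓ.Prime]

/-- **Silverman, *AEC*, Prop. III.8.6 (= Prop. V.2.3), determinant part**: for an elliptic
curve `E / K`, a prime `ℓ ≠ char K` and `φ ∈ End(E)`, the induced map `φ_ℓ : T_ℓ(E) → T_ℓ(E)`
has `det(φ_ℓ) = deg(φ)` (proved in the source with the Weil pairing: `e(v₁, v₂)^{deg φ} =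
e(φ̂_ℓ φ_ℓ v₁, v₂) = e(φ_ℓ v₁, φ_ℓ v₂) = e(v₁, v₂)^{det φ_ℓ}`). Vendored for the non-zero
endomorphisms defined over `K` (the prelude's `Isogeny W W`), with `deg` the degree
`[K̄(E) : φ^* K̄(E)]` of `Literature.NumberTheory.EllipticCurves.IsogenyDegree`; the identity is
read in `ℤ_ℓ` (`char ℤ_ℓ = 0`, no loss). The trace part `tr(φ_ℓ) = 1 + deg(φ) - deg(1 - φ)` of
III.8.6 follows from this one by "`tr(A) = 1 + det(A) - det(1 - A)` for any `2 × 2` matrix `A`"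
(`trace_eq_one_add_det_sub_det` below). Status: reduced to Cor. III.6.3 —
`Isogeny.det_tateModule_map_eq_deg_of_isQuadraticForm : degHom_isQuadraticForm W W → this`
(`Literature.NumberTheory.EllipticCurves.IsogenyDeterminantProofs`).
[cite: SilvermanAEC2009, Prop. III.8.6] -/
def Isogeny.det_tateModule_map_eq_deg : Prop :=
  ∀ [W.IsElliptic], (ℓ : K) ≠ 0 → ∀ φ : Isogeny W W,
    LinearMap.det (TateModule.map ℓ φ.toAddMonoidHom) = (φ.deg : ℤ_[ℓ])

/-- **Silverman, *AEC*, Prop. II.2.11(c)** for an elliptic curve over a finite field `k` with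
`q` elements: the `q`-power Frobenius morphism `φ : E → E^{(q)} = E` has degree `deg φ = q`
(and is purely inseparable, II.2.11(b): `φ^* K̄(E) = K̄(E)^q`). Here `φ` is `frobeniusIsogeny`
(for the arithmetic Frobenius `σ_q`, `σ_q x = x ^ q`) and `deg` is `[K̄(E) : φ^* K̄(E)]`
(`Isogeny.deg` of `IsogenyDegree`, with `φ^* x = x ^ q`, `φ^* y = y ^ q`). Used in the proof of
Thm. V.2.3.1 as "`det(φ_ℓ) = deg(φ) = q`". Status: **proved**, `frobeniusIsogeny_deg_eq_card_holds`
(`Literature.NumberTheory.EllipticCurves.FrobeniusDegreeProofs`); consumers `(h : …)` are fed it.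
[cite: SilvermanAEC2009, Prop. II.2.11(c)] -/
def frobeniusIsogeny_deg_eq_card : Prop :=
  ∀ [Finite K] [W.IsElliptic] (σ : Field.absoluteGaloisGroup K)
    (hσ : ∀ x : AlgebraicClosure K, σ • x = x ^ Nat.card K), (W.frobeniusIsogeny hσ).deg = Nat.card K

/-- **Silverman, *AEC*, Cor. III.5.5 (last sentence)**: for an elliptic curve over a finite field
with `q` elements and its `q`-power Frobenius endomorphism `φ`, "the map `1 - φ` is separable",
i.e. `K̄(E)` is a separable extension of `(1 - φ)^* K̄(E)` (the source proves more generally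
that `m + nφ` is separable iff `p ∤ m`, via invariant differentials: `(m + nφ)^* ω = m ω`).
Here `1 - φ` is `oneSubFrobeniusIsogeny` and `(1 - φ)^* K̄(E)` its `Isogeny.pullbackField`.
Status: **proved**, `isSeparable_oneSubFrobeniusIsogeny_holds`
(`Literature.NumberTheory.EllipticCurves.FrobeniusSeparableProofs`).
[cite: SilvermanAEC2009, Cor. III.5.5] -/
def isSeparable_oneSubFrobeniusIsogeny : Prop :=
  ∀ [Finite K] [W.IsElliptic] (σ : Field.absoluteGaloisGroup K)
    (hσ : ∀ x : AlgebraicClosure K, σ • x = x ^ Nat.card K),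
    Algebra.IsSeparable (W.oneSubFrobeniusIsogeny hσ).pullbackField W.geomFunctionField

end Facts

/-! ## `tr(A) = 1 + det(A) - det(1 - A)` on the rank-two Tate module -/

section LinearAlgebra

variable {W : WeierstrassCurve K} {ℓ : ℕ} [Fact ℓ.Prime]

/-- "For any `2 × 2` matrix `A`, a trivial calculation yields `tr(A) = 1 + det(A) - det(1 - A)`"
(Silverman, *AEC*, end of the proof of Prop. III.8.6), for endomorphisms of the free rank-`2`
`ℤ_ℓ`-module `T_ℓ E` (`ℓ ≠ char K`; the tree's `module_free_tateModule_holds`,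
`finrank_tateModule_eq_two_holds`). [cite: SilvermanAEC2009, proof of Prop. III.8.6] -/
theorem trace_eq_one_add_det_sub_det [W.IsElliptic] (hℓ : (ℓ : K) ≠ 0)
    (f : W.tateModule ℓ →ₗ[ℤ_[ℓ]] W.tateModule ℓ) :
    LinearMap.trace ℤ_[ℓ] (W.tateModule ℓ) f =
      1 + LinearMap.det f - LinearMap.det (LinearMap.id - f) := by
  haveI := module_free_tateModule_holds W ℓ
  haveI := module_finite_tateModule_holds W ℓ
  let b := Module.finBasisOfFinrankEq ℤ_[ℓ] (W.tateModule ℓ) (finrank_tateModule_eq_two_holds W ℓ hℓ)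
  rw [LinearMap.trace_eq_matrix_trace ℤ_[ℓ] b, ← LinearMap.det_toMatrix b, ← LinearMap.det_toMatrix b,
    map_sub, LinearMap.toMatrix_id, Matrix.trace_fin_two, Matrix.det_fin_two, Matrix.det_fin_two]
  simp only [Matrix.sub_apply, Matrix.one_apply_eq, Matrix.one_apply_ne (by decide : (0 : Fin 2) ≠ 1),
    Matrix.one_apply_ne (by decide : (1 : Fin 2) ≠ 0)]
  ring

end LinearAlgebra

/-! ## Silverman, *AEC*, Thm. V.2.3.1 (proof): `det(φ_ℓ) = q` and `tr(φ_ℓ) = q + 1 - #E(k)` -/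

section Assembly

variable (W : WeierstrassCurve K) (ℓ : ℕ) [Fact ℓ.Prime]

/-- **`det(φ_ℓ) = q`** (Silverman, *AEC*, proof of Thm. V.2.3.1: "`det(φ_ℓ) = deg(φ) = q`"),
from III.8.6 (`h86`) and II.2.11(c) (`hdeg`): the determinant of the arithmetic Frobenius `σ_q`
on `T_ℓ E`, `ℓ ≠ char k`, is `q`. [cite: SilvermanAEC2009, Thm. V.2.3.1 (proof)] -/
theorem det_galoisRepTate_frobenius_of_facts (h86 : Isogeny.det_tateModule_map_eq_deg W ℓ)
    (hdeg : W.frobeniusIsogeny_deg_eq_card) [Finite K] [W.IsElliptic] (hℓ : (ℓ : K) ≠ 0)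
    {σ : Field.absoluteGaloisGroup K} (hσ : ∀ x : AlgebraicClosure K, σ • x = x ^ Nat.card K) :
    LinearMap.det (W.galoisRepTate ℓ σ : W.tateModule ℓ →ₗ[ℤ_[ℓ]] W.tateModule ℓ) =
      (Nat.card K : ℤ_[ℓ]) := by
  rw [← tateModule_map_frobeniusIsogeny W hσ ℓ, h86 hℓ, hdeg σ hσ]

/-- **`#E(𝔽_q) = deg(1 - φ)`** (Silverman, *AEC*, proof of Thm. V.1.1: "`E(𝔽_q) = ker(1 - φ)`, so
using (III.5.5) and (III.4.10c), `#E(𝔽_q) = #ker(1 - φ) = deg(1 - φ)`"), from III.4.10(a)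
(`h410`: `#ker = deg_s`) and III.5.5 (`h55`: `1 - φ` is separable, so `deg_s = deg`; Mathlib's
`Field.finSepDegree_eq_finrank_of_isSeparable` needs no finiteness hypothesis, both sides being `0`
for an infinite extension, so II.2.4(a) is not invoked). [cite: SilvermanAEC2009, Thm. V.1.1 (proof)] -/
theorem deg_oneSubFrobeniusIsogeny_eq_card_of_facts (h410 : Isogeny.card_ker_eq_finSepDegree W W)
    (h55 : W.isSeparable_oneSubFrobeniusIsogeny) [Finite K] [W.IsElliptic]
    {σ : Field.absoluteGaloisGroup K} (hσ : ∀ x : AlgebraicClosure K, σ • x = x ^ Nat.card K) :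
    (W.oneSubFrobeniusIsogeny hσ).deg = Nat.card W.toAffine.Point := by
  haveI := h55 σ hσ
  rw [← card_ker_oneSubFrobeniusIsogeny W hσ, h410, Isogeny.deg,
    Field.finSepDegree_eq_finrank_of_isSeparable]

/-- **`tr(φ_ℓ) = 1 + q - #E(𝔽_q)`** (Silverman, *AEC*, proof of Thm. V.2.3.1:
"`tr(φ_ℓ) = 1 + deg(φ) - deg(1 - φ) = 1 + q - #E(𝔽_q)`"), from III.8.6 (`h86`, at `φ` and at
`1 - φ`, through `tr(A) = 1 + det(A) - det(1 - A)`), II.2.11(c) (`hdeg`), III.4.10(a) (`h410`)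
and III.5.5 (`h55`): the trace of the arithmetic Frobenius `σ_q` on `T_ℓ E`, `ℓ ≠ char k`, is
`q + 1 - #E(k)` in `ℤ_ℓ`. [cite: SilvermanAEC2009, Thm. V.2.3.1 (proof)] -/
theorem trace_galoisRepTate_frobenius_of_facts (h86 : Isogeny.det_tateModule_map_eq_deg W ℓ)
    (hdeg : W.frobeniusIsogeny_deg_eq_card) (h410 : Isogeny.card_ker_eq_finSepDegree W W)
    (h55 : W.isSeparable_oneSubFrobeniusIsogeny)
    [Finite K] [W.IsElliptic] (hℓ : (ℓ : K) ≠ 0) {σ : Field.absoluteGaloisGroup K}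
    (hσ : ∀ x : AlgebraicClosure K, σ • x = x ^ Nat.card K) :
    LinearMap.trace ℤ_[ℓ] (W.tateModule ℓ) (W.galoisRepTate ℓ σ) =
      (Nat.card K : ℤ_[ℓ]) + 1 - (Nat.card W.toAffine.Point : ℤ_[ℓ]) := by
  rw [trace_eq_one_add_det_sub_det hℓ, det_galoisRepTate_frobenius_of_facts W ℓ h86 hdeg hℓ hσ,
    ← tateModule_map_oneSubFrobeniusIsogeny W hσ ℓ, h86 hℓ,
    deg_oneSubFrobeniusIsogeny_eq_card_of_facts W h410 h55 hσ]
  ring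

end Assembly

end WeierstrassCurve
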